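import Literature.Topology.FourManifolds.RegularLevelSplitting
import Literature.Topology.FourManifolds.LickorishWallace
import Mathlib.Analysis.Calculus.FDeriv.Pow
import Mathlib.LinearAlgebra.QuadraticForm.Signature
import HarnessLib

/-!
# A genus-one handlebody: the solid torus as a regular sublevel set of a Morse function on `ℝ³`

Topic `Literature/Topology/FourManifolds` (fact seat `provefact-Literature.SPC4.exists_isIntegralSurgeryLink`,
the Lickorish–Wallace theorem; non-vacuity of the notion `Literature.IsHandlebody g` of
`LickorishWallace.lean` for `g = 1`, and a concrete smooth model of the solid torus
`S¹ × D²` — Lickorish's "solid tori" which are cut out and sewn back, *Ann. of Math.* 76 (1962),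
Thm. 2 — as a compact `3`-manifold with boundary modelled on `𝓡∂ 3`).  Everything here is
**proved**; so far only the genus-`0` handlebody `𝔻³` was exhibited
(`Literature.Topology.FourManifolds.isHandlebody_zero_closedBall`).

We take the polynomial
`f(x, y, z) = (x² + y²)² - 392 (x² + y²) + z² - 3840 x` on `ℝ³` (`Literature.Topology.FourManifolds.SolidTorusModel.fn`; a
"Mexican hat" in the `(x, y)`-plane, tilted by the linear term so that the circle of minima
breaks up into one minimum and one saddle, and thickened by `z²`; the coefficients are chosen
so that all critical points are rational: `∂f/∂x = 4 (x - 16)(x + 10)(x + 6)` on the `x`-axis).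
Then (all proved by explicit differentiation in the model vector space, where
`mfderiv = fderiv` and the tree's Hessian `Literature.Topology.FourManifolds.mhessian` is the second Fréchet derivative,
`mhessian_apply`):

* `dfn_eq_zero_iff`, `isMCriticalPt_iff'`: the critical points are `(16, 0, 0)`, `(-10, 0, 0)`,
  `(-6, 0, 0)`;
* `mhessian_axisPt`: the Hessian at `(x, 0, 0)` is the diagonal form
  `(12x² - 784) v₀w₀ + (4x² - 784) v₁w₁ + 2 v₂w₂`, nondegenerate at the three critical points
  (`isMorse_fn`: **`f` is a Morse function on the manifold `ℝ³`**), with Morse indices `0`, `1`,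
  `2` respectively (`morseIndex_axisPt_16/_neg_10/_neg_6`, by Sylvester's law in Mathlib's form
  `QuadraticForm.sigNeg_of_equiv_weightedSumSquares`: count the negative weights), and critical
  values `-96256 < 9200 < 10224` (`criticalSetOfIndex_fn`, `fn_axisPt_*`);
* `isRegularLevel_fn`: `10000` is a regular level, between the saddle and the index-`2` point;
* `Literature.SolidTorusModel.SolidTorus := RegularSublevel isRegularLevel_fn`, the sublevel set
  `V₁ = {f ≤ 10000}` with the manifold-with-boundary structure of `RegularLevelSplitting.lean`
  (boundary the torus `{f = 10000}`); it is compact (`isCompact_preimage_fn`: an a priori bound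
  `‖p‖² ≤ 1400000` on `{f ≤ 10000}`), connected (one critical point of index `0`:
  `Literature.Topology.FourManifolds.isConnected_preimage_Iic_of_isCompact`, the variant of Reeb's argument of
  `RegularLevelSplitting.lean` for a non-compact ambient manifold), orientable (pullback from
  `ℝ³`), and `f|V₁ - 9999` is a Morse function adapted to the boundary with one critical point
  of index `0` and one of index `1` (`hasHandleDecomposition_solidTorus`);
* **`isHandlebody_one_solidTorus : IsHandlebody 1 SolidTorus`** — a genus-`1` handlebody
  (Schultens, *Introduction to 3-Manifolds* (2014), Def. 6.1.5: handlebody = `0`-handles and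
  `1`-handles; the solid torus `S¹ × D²` is the handlebody of genus one, Example 6.1.9 /
  Fig. 6.2).

## References

* J. Schultens, *Introduction to 3-Manifolds*, GSM 151, AMS (2014), Def. 6.1.5,
  Examples 6.1.8–6.1.9. [Schultens2014]
* J. Milnor, *Morse theory*, Ann. of Math. Studies 51 (1963), §3, Thm. 3.1 and proof of
  Thm. 4.1. [Milnor1963]
* W. B. R. Lickorish, *A representation of orientable combinatorial 3-manifolds*, Ann. of Math.
  76 (1962), Thm. 2. [LickorishAnnals1962]
-/

open scoped Manifold ContDiff Topology
open Set Function Filter Metric Module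

noncomputable section

universe u

namespace Literature.Topology.FourManifolds

/-- Local notation: `𝔼 n` is the model Euclidean space `EuclideanSpace ℝ (Fin n)`. -/
local notation "𝔼 " n:arg => EuclideanSpace ℝ (Fin n)

namespace SolidTorusModel

/-- The coordinate functionals `πᵢ : ℝ³ →L ℝ`. [folklore] -/
abbrev π (i : Fin 3) : (𝔼 3) →L[ℝ] ℝ := EuclideanSpace.proj i

/-- `πᵢ v = vᵢ` (definitional). [folklore] -/
@[simp] theorem π_apply (i : Fin 3) (v : 𝔼 3) : π i v = v i := rfl

/-- **The Morse function** `f(x, y, z) = (x² + y²)² - 392 (x² + y²) + z² - 3840 x` on `ℝ³`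
(a tilted "Mexican hat" in the plane thickened by `z²`): its critical points are `(16, 0, 0)`
(index `0`, value `-96256`), `(-10, 0, 0)` (index `1`, value `9200`) and `(-6, 0, 0)`
(index `2`, value `10224`), so that the sublevel set `{f ≤ 10000}` is a solid torus presented
with one `0`-handle and one `1`-handle. [folklore] -/
def fn (p : 𝔼 3) : ℝ :=
  (p 0 ^ 2 + p 1 ^ 2) ^ 2 - 392 * (p 0 ^ 2 + p 1 ^ 2) + p 2 ^ 2 - 3840 * p 0

/-- `∂f/∂x`. [folklore] -/
def fnA (p : 𝔼 3) : ℝ := 4 * (p 0 ^ 2 + p 1 ^ 2) * p 0 - 784 * p 0 - 3840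
/-- `∂f/∂y`. [folklore] -/
def fnB (p : 𝔼 3) : ℝ := 4 * (p 0 ^ 2 + p 1 ^ 2) * p 1 - 784 * p 1
/-- `∂f/∂z`. [folklore] -/
def fnC (p : 𝔼 3) : ℝ := 2 * p 2

/-- The differential of `f` at `p`, `df = f_x dx + f_y dy + f_z dz`. [folklore] -/
def dfn (p : 𝔼 3) : (𝔼 3) →L[ℝ] ℝ := fnA p • π 0 + fnB p • π 1 + fnC p • π 2

/-- `dfn` evaluated. [folklore] -/
@[simp] theorem dfn_apply (p v : 𝔼 3) : dfn p v = fnA p * v 0 + fnB p * v 1 + fnC p * v 2 := by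
  simp [dfn, smul_eq_mul]

/-- The coordinate functions are differentiable with differential `πᵢ`. [folklore] -/
theorem hasFDerivAt_coord (i : Fin 3) (p : 𝔼 3) : HasFDerivAt (fun q : 𝔼 3 => q i) (π i) p := by
  have h := (π i).hasFDerivAt (x := p)
  rwa [EuclideanSpace.coe_proj] at h

/-- `f` is differentiable with differential `dfn`. [folklore] -/
theorem hasFDerivAt_fn (p : 𝔼 3) : HasFDerivAt fn (dfn p) p := by
  have h0 := hasFDerivAt_coord 0 p
  have h1 := hasFDerivAt_coord 1 p
  have h2 := hasFDerivAt_coord 2 p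
  have hs : HasFDerivAt (fun q : 𝔼 3 => q 0 ^ 2 + q 1 ^ 2)
      ((2 * p 0) • π 0 + (2 * p 1) • π 1) p := by
    have h := (h0.pow 2).add (h1.pow 2)
    have h' : HasFDerivAt (fun q : 𝔼 3 => q 0 ^ 2 + q 1 ^ 2) _ p :=
      h.congr_of_eventuallyEq (Filter.Eventually.of_forall fun q => rfl)
    refine h'.congr_fderiv ?_
    ext v
    simp [smul_eq_mul]
  have hf := (((hs.pow 2).sub (hs.const_mul 392)).add (h2.pow 2)).sub (h0.const_mul 3840)
  have hf' : HasFDerivAt fn _ p := hf.congr_of_eventuallyEq (Filter.Eventually.of_forall fun q => rfl)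
  refine hf'.congr_fderiv ?_
  ext v
  simp [dfn, fnA, fnB, fnC, smul_eq_mul]
  ring

/-- `fderiv f = dfn`. [folklore] -/
theorem fderiv_fn : fderiv ℝ fn = dfn := funext fun p => (hasFDerivAt_fn p).fderiv

/-- `f` is differentiable. [folklore] -/
theorem differentiable_fn : Differentiable ℝ fn := fun p => (hasFDerivAt_fn p).differentiableAt

/-- `f` is smooth (a polynomial in the coordinates). [folklore] -/
theorem contDiff_fn : ContDiff ℝ ∞ fn := by
  unfold fn
  fun_prop

/-! #### The three critical points -/

/-- The point `(x, 0, 0)`. [folklore] -/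
def axisPt (x : ℝ) : 𝔼 3 := EuclideanSpace.single 0 x

/-- Coordinates of `(x, 0, 0)`. [folklore] -/
@[simp] theorem axisPt_zero (x : ℝ) : axisPt x 0 = x := by simp [axisPt]
/-- Coordinates of `(x, 0, 0)`. [folklore] -/
@[simp] theorem axisPt_one (x : ℝ) : axisPt x 1 = 0 := by simp [axisPt]
/-- Coordinates of `(x, 0, 0)`. [folklore] -/
@[simp] theorem axisPt_two (x : ℝ) : axisPt x 2 = 0 := by simp [axisPt]

/-- `x ↦ (x, 0, 0)` is injective. [folklore] -/
theorem axisPt_injective : Injective axisPt := fun x y h => by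
  have := congrArg (fun p : 𝔼 3 => p 0) h
  simpa using this

/-- A point with vanishing `y`- and `z`-coordinates is on the axis. [folklore] -/
theorem eq_axisPt_of {p : 𝔼 3} (h1 : p 1 = 0) (h2 : p 2 = 0) : p = axisPt (p 0) := by
  ext i
  fin_cases i <;> simp [h1, h2]

/-- **The critical points of `f`**: `df(p) = 0` iff `p ∈ {(16,0,0), (-10,0,0), (-6,0,0)}`. [folklore] -/
theorem dfn_eq_zero_iff (p : 𝔼 3) :
    dfn p = 0 ↔ p = axisPt 16 ∨ p = axisPt (-10) ∨ p = axisPt (-6) := by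
  constructor
  · intro h
    have hA : fnA p = 0 := by simpa using congrArg (fun L : (𝔼 3) →L[ℝ] ℝ => L (EuclideanSpace.single 0 1)) h
    have hB : fnB p = 0 := by simpa using congrArg (fun L : (𝔼 3) →L[ℝ] ℝ => L (EuclideanSpace.single 1 1)) h
    have hC : fnC p = 0 := by simpa using congrArg (fun L : (𝔼 3) →L[ℝ] ℝ => L (EuclideanSpace.single 2 1)) h
    simp only [fnA, fnB, fnC] at hA hB hC
    have h2 : p 2 = 0 := by linarith
    have h1 : p 1 = 0 := by
      by_contra h1
      have hs : 4 * (p 0 ^ 2 + p 1 ^ 2) - 784 = 0 := by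
        have : (4 * (p 0 ^ 2 + p 1 ^ 2) - 784) * p 1 = 0 := by linarith
        rcases mul_eq_zero.1 this with h | h
        · exact h
        · exact absurd h h1
      have h' : (4 * (p 0 ^ 2 + p 1 ^ 2) - 784) * p 0 = 0 := by rw [hs, zero_mul]
      linarith
    rw [h1] at hA
    have hcubic : (p 0 - 16) * (p 0 + 10) * (p 0 + 6) = 0 := by nlinarith
    have hp : p = axisPt (p 0) := eq_axisPt_of h1 h2
    rcases mul_eq_zero.1 hcubic with h | h
    · rcases mul_eq_zero.1 h with h | h
      · left; rw [hp]; congr 1; linarith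
      · right; left; rw [hp]; congr 1; linarith
    · right; right; rw [hp]; congr 1; linarith
  · rintro (rfl | rfl | rfl) <;>
    · ext v
      simp [fnA, fnB, fnC]
      norm_num

/-! #### The Hessian -/

/-- `d(∂f/∂x)`. [folklore] -/
def dfnA (p : 𝔼 3) : (𝔼 3) →L[ℝ] ℝ :=
  (12 * p 0 ^ 2 + 4 * p 1 ^ 2 - 784) • π 0 + (8 * p 0 * p 1) • π 1
/-- `d(∂f/∂y)`. [folklore] -/
def dfnB (p : 𝔼 3) : (𝔼 3) →L[ℝ] ℝ :=
  (8 * p 0 * p 1) • π 0 + (4 * p 0 ^ 2 + 12 * p 1 ^ 2 - 784) • π 1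
/-- `d(∂f/∂z)`. [folklore] -/
def dfnC (_p : 𝔼 3) : (𝔼 3) →L[ℝ] ℝ := (2 : ℝ) • π 2

/-- `∂f/∂x` is differentiable with differential `dfnA`. [folklore] -/
theorem hasFDerivAt_fnA (p : 𝔼 3) : HasFDerivAt fnA (dfnA p) p := by
  have h0 := hasFDerivAt_coord 0 p
  have h1 := hasFDerivAt_coord 1 p
  have h := ((((h0.pow 2).add (h1.pow 2)).const_mul 4).mul h0).sub (h0.const_mul 784)
    |>.sub_const 3840
  have h' : HasFDerivAt fnA _ p := h.congr_of_eventuallyEq (Filter.Eventually.of_forall fun q => rfl)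
  refine h'.congr_fderiv ?_
  ext v
  simp [dfnA, smul_eq_mul]
  ring

/-- `∂f/∂y` is differentiable with differential `dfnB`. [folklore] -/
theorem hasFDerivAt_fnB (p : 𝔼 3) : HasFDerivAt fnB (dfnB p) p := by
  have h0 := hasFDerivAt_coord 0 p
  have h1 := hasFDerivAt_coord 1 p
  have h := ((((h0.pow 2).add (h1.pow 2)).const_mul 4).mul h1).sub (h1.const_mul 784)
  have h' : HasFDerivAt fnB _ p := h.congr_of_eventuallyEq (Filter.Eventually.of_forall fun q => rfl)
  refine h'.congr_fderiv ?_
  ext v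
  simp [dfnB, smul_eq_mul]
  ring

/-- `∂f/∂z` is differentiable with differential `dfnC`. [folklore] -/
theorem hasFDerivAt_fnC (p : 𝔼 3) : HasFDerivAt fnC (dfnC p) p := by
  have h2 := hasFDerivAt_coord 2 p
  have h := h2.const_mul 2
  have h' : HasFDerivAt fnC _ p := h.congr_of_eventuallyEq (Filter.Eventually.of_forall fun q => rfl)
  refine h'.congr_fderiv ?_
  ext v
  simp [dfnC, smul_eq_mul]

/-- The second differential of `f` at `p`. [folklore] -/
def d2fn (p : 𝔼 3) : (𝔼 3) →L[ℝ] (𝔼 3) →L[ℝ] ℝ :=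
  (dfnA p).smulRight (π 0) + (dfnB p).smulRight (π 1) + (dfnC p).smulRight (π 2)

/-- `df` is differentiable with differential `d2fn`. [folklore] -/
theorem hasFDerivAt_dfn (p : 𝔼 3) : HasFDerivAt dfn (d2fn p) p := by
  have h := (((hasFDerivAt_fnA p).smul_const (π 0)).add ((hasFDerivAt_fnB p).smul_const (π 1))).add
    ((hasFDerivAt_fnC p).smul_const (π 2))
  exact h.congr_of_eventuallyEq (Filter.Eventually.of_forall fun q => rfl)

/-- The second Fréchet derivative of `f` is `d2fn`. [folklore] -/
theorem fderiv_fderiv_fn (p : 𝔼 3) : fderiv ℝ (fderiv ℝ fn) p = d2fn p := by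
  rw [fderiv_fn]
  exact (hasFDerivAt_dfn p).fderiv

/-- `d2fn` evaluated. [folklore] -/
@[simp]
theorem d2fn_apply_apply (p v w : 𝔼 3) :
    d2fn p v w = dfnA p v * w 0 + dfnB p v * w 1 + dfnC p v * w 2 := by
  simp [d2fn, smul_eq_mul]

/-- **The Hessian of `f` at a point of the `x`-axis** is the diagonal form
`(12x² - 784) v₀w₀ + (4x² - 784) v₁w₁ + 2 v₂w₂`. [folklore] -/
theorem d2fn_axisPt (x : ℝ) (v w : 𝔼 3) :
    d2fn (axisPt x) v w =
      (12 * x ^ 2 - 784) * (v 0 * w 0) + (4 * x ^ 2 - 784) * (v 1 * w 1) + 2 * (v 2 * w 2) := by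
  simp [dfnA, dfnB, dfnC, smul_eq_mul]
  ring

/-! #### `f` as a Morse function on the manifold `ℝ³` -/

/-- Criticality of `f` on the model manifold `ℝ³` is the vanishing of `df`. [folklore] -/
theorem isMCriticalPt_iff (p : 𝔼 3) : IsMCriticalPt (𝓡 3) fn p ↔ dfn p = 0 := by
  rw [IsMCriticalPt, mfderiv_eq_fderiv, fderiv_fn]
  exact Iff.rfl

/-- The critical points of `f` on the manifold `ℝ³`. [folklore] -/
theorem isMCriticalPt_iff' (p : 𝔼 3) :
    IsMCriticalPt (𝓡 3) fn p ↔ p = axisPt 16 ∨ p = axisPt (-10) ∨ p = axisPt (-6) := by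
  rw [isMCriticalPt_iff, dfn_eq_zero_iff]

/-- **The Hessian of `f` on the model manifold `ℝ³` is the second differential.** [folklore] -/
theorem mhessian_apply (p v w : 𝔼 3) : mhessian (𝓡 3) fn p v w = d2fn p v w := by
  have h1 : writtenInExtChartAt (𝓡 3) 𝓘(ℝ, ℝ) p fn = fn := by
    ext q
    simp [writtenInExtChartAt]
  have h2 : extChartAt (𝓡 3) p p = p := by simp
  have h3 : range (𝓡 3) = univ := by simp
  change (fderivWithin ℝ (fderivWithin ℝ (writtenInExtChartAt (𝓡 3) 𝓘(ℝ, ℝ) p fn) (range (𝓡 3)))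
    (range (𝓡 3)) (extChartAt (𝓡 3) p p) v) w = _
  rw [h1, h3, h2, fderivWithin_univ, fderivWithin_univ, fderiv_fderiv_fn]

/-- The Hessian at an axis point, explicitly. [folklore] -/
theorem mhessian_axisPt (x : ℝ) (v w : 𝔼 3) :
    mhessian (𝓡 3) fn (axisPt x) v w =
      (12 * x ^ 2 - 784) * (v 0 * w 0) + (4 * x ^ 2 - 784) * (v 1 * w 1) + 2 * (v 2 * w 2) := by
  rw [mhessian_apply, d2fn_axisPt]

/-- A diagonal bilinear form on `ℝ³` with nonzero diagonal entries is nondegenerate. [folklore] -/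
theorem nondegenerate_of_diag {B : LinearMap.BilinForm ℝ (𝔼 3)} {a b c : ℝ} (ha : a ≠ 0)
    (hb : b ≠ 0) (hc : c ≠ 0)
    (hB : ∀ v w, B v w = a * (v 0 * w 0) + b * (v 1 * w 1) + c * (v 2 * w 2)) :
    B.Nondegenerate := by
  have key : ∀ v : 𝔼 3, (∀ w, B v w = 0) → v = 0 := by
    intro v hv
    have e0 := hv (EuclideanSpace.single 0 1)
    have e1 := hv (EuclideanSpace.single 1 1)
    have e2 := hv (EuclideanSpace.single 2 1)
    rw [hB] at e0 e1 e2
    simp at e0 e1 e2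
    ext i
    fin_cases i
    · simpa [ha] using e0
    · simpa [hb] using e1
    · simpa [hc] using e2
  have key' : ∀ w : 𝔼 3, (∀ v, B v w = 0) → w = 0 := by
    intro w hw
    refine key w fun v => ?_
    rw [hB, ← hw v, hB]
    ring
  exact ⟨fun v hv => key v hv, fun w hw => key' w hw⟩

/-- The Hessian at the three critical points is nondegenerate. [folklore] -/
theorem nondegenerate_mhessian_axisPt {x : ℝ} (hx : x = 16 ∨ x = -10 ∨ x = -6) :
    (mhessian (𝓡 3) fn (axisPt x)).Nondegenerate := by
  refine nondegenerate_of_diag (a := 12 * x ^ 2 - 784) (b := 4 * x ^ 2 - 784) (c := 2) ?_ ?_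
    two_ne_zero (mhessian_axisPt x)
  · rcases hx with rfl | rfl | rfl <;> norm_num
  · rcases hx with rfl | rfl | rfl <;> norm_num

/-- **`f` is a Morse function on `ℝ³`.** [folklore] -/
theorem isMorse_fn : IsMorse (𝓡 3) fn := by
  refine ⟨contDiff_fn.contMDiff, fun p hp => ?_⟩
  rcases (isMCriticalPt_iff' p).1 hp with rfl | rfl | rfl
  · exact nondegenerate_mhessian_axisPt (Or.inl rfl)
  · exact nondegenerate_mhessian_axisPt (Or.inr (Or.inl rfl))
  · exact nondegenerate_mhessian_axisPt (Or.inr (Or.inr rfl))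

/-! #### Morse indices (Sylvester: count the negative diagonal entries) -/

/-- The quadratic form of the Hessian at an axis point is the weighted sum of squares with
weights `(12x² - 784, 4x² - 784, 2)`, transported along `ℝ³ ≅ (Fin 3 → ℝ)`. [folklore] -/
theorem equivalent_weightedSumSquares_axisPt (x : ℝ) :
    QuadraticMap.Equivalent (mhessian (𝓡 3) fn (axisPt x)).toQuadraticMap
      (QuadraticMap.weightedSumSquares ℝ ![12 * x ^ 2 - 784, 4 * x ^ 2 - 784, 2]) := by
  refine ⟨{ toLinearEquiv := (WithLp.linearEquiv 2 ℝ (Fin 3 → ℝ)), map_app' := fun v => ?_ }⟩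
  rw [QuadraticMap.weightedSumSquares_apply, LinearMap.BilinMap.toQuadraticMap_apply,
    mhessian_axisPt]
  simp [Fin.sum_univ_three, smul_eq_mul]

/-- **The Morse index at an axis critical point is the number of negative Hessian weights.**
[folklore] -/
theorem morseIndex_axisPt (x : ℝ) :
    morseIndex (𝓡 3) fn (axisPt x) =
      {i : Fin 3 | (![12 * x ^ 2 - 784, 4 * x ^ 2 - 784, 2] : Fin 3 → ℝ) i < 0}.ncard := by
  unfold morseIndex
  exact QuadraticForm.sigNeg_of_equiv_weightedSumSquares (equivalent_weightedSumSquares_axisPt x)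

/-- The critical point `(16, 0, 0)` has index `0` (weights `2288, 240, 2`). [folklore] -/
theorem morseIndex_axisPt_16 : morseIndex (𝓡 3) fn (axisPt 16) = 0 := by
  rw [morseIndex_axisPt]
  have : {i : Fin 3 | (![12 * (16 : ℝ) ^ 2 - 784, 4 * (16 : ℝ) ^ 2 - 784, 2] : Fin 3 → ℝ) i < 0} = ∅ := by
    ext i
    fin_cases i <;> norm_num
  rw [this, ncard_empty]

/-- The critical point `(-10, 0, 0)` has index `1` (weights `416, -384, 2`). [folklore] -/
theorem morseIndex_axisPt_neg_10 : morseIndex (𝓡 3) fn (axisPt (-10)) = 1 := by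
  rw [morseIndex_axisPt]
  have : {i : Fin 3 | (![12 * (-10 : ℝ) ^ 2 - 784, 4 * (-10 : ℝ) ^ 2 - 784, 2] : Fin 3 → ℝ) i < 0}
      = {1} := by
    ext i
    fin_cases i <;> norm_num
  rw [this, ncard_singleton]

/-- The critical point `(-6, 0, 0)` has index `2` (weights `-352, -640, 2`). [folklore] -/
theorem morseIndex_axisPt_neg_6 : morseIndex (𝓡 3) fn (axisPt (-6)) = 2 := by
  rw [morseIndex_axisPt]
  have : {i : Fin 3 | (![12 * (-6 : ℝ) ^ 2 - 784, 4 * (-6 : ℝ) ^ 2 - 784, 2] : Fin 3 → ℝ) i < 0}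
      = {0, 1} := by
    ext i
    fin_cases i <;> norm_num
  rw [this, ncard_pair]
  decide

/-- **The critical points of `f` of each index.** [folklore] -/
theorem criticalSetOfIndex_fn (i : ℕ) :
    criticalSetOfIndex (𝓡 3) fn i =
      if i = 0 then {axisPt 16} else if i = 1 then {axisPt (-10)} else if i = 2 then {axisPt (-6)}
      else ∅ := by
  ext p
  simp only [mem_criticalSetOfIndex, isMCriticalPt_iff']
  constructor
  · rintro ⟨hp | hp | hp, hi⟩ <;> subst hp
    · rw [morseIndex_axisPt_16] at hi; subst hi; simp
    · rw [morseIndex_axisPt_neg_10] at hi; subst hi; simp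
    · rw [morseIndex_axisPt_neg_6] at hi; subst hi; simp
  · intro hp
    split_ifs at hp with h0 h1 h2
    · subst h0; rw [mem_singleton_iff] at hp; subst hp
      exact ⟨Or.inl rfl, morseIndex_axisPt_16⟩
    · subst h1; rw [mem_singleton_iff] at hp; subst hp
      exact ⟨Or.inr (Or.inl rfl), morseIndex_axisPt_neg_10⟩
    · subst h2; rw [mem_singleton_iff] at hp; subst hp
      exact ⟨Or.inr (Or.inr rfl), morseIndex_axisPt_neg_6⟩
    · exact absurd hp (notMem_empty _)

/-- The values of `f` at the critical points. [folklore] -/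
theorem fn_axisPt (x : ℝ) : fn (axisPt x) = x ^ 4 - 392 * x ^ 2 - 3840 * x := by
  simp [fn]; ring

/-- The minimum value `f(16, 0, 0) = -96256`. [folklore] -/
theorem fn_axisPt_16 : fn (axisPt 16) = -96256 := by rw [fn_axisPt]; norm_num
/-- The saddle value `f(-10, 0, 0) = 9200`. [folklore] -/
theorem fn_axisPt_neg_10 : fn (axisPt (-10)) = 9200 := by rw [fn_axisPt]; norm_num
/-- The value `f(-6, 0, 0) = 10224` at the index-`2` point. [folklore] -/
theorem fn_axisPt_neg_6 : fn (axisPt (-6)) = 10224 := by rw [fn_axisPt]; norm_num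

/-! #### The regular level `10000` and the solid torus `V₁ = {f ≤ 10000}` -/

/-- **`10000` is a regular level of `f`** (the critical values are `-96256`, `9200`, `10224`).
[folklore] -/
theorem isRegularLevel_fn : IsRegularLevel (𝓡 3) fn 10000 :=
  isMorse_fn.isRegularLevel fun z hz => by
    rcases (isMCriticalPt_iff' z).1 hz with rfl | rfl | rfl
    · rw [fn_axisPt_16]; norm_num
    · rw [fn_axisPt_neg_10]; norm_num
    · rw [fn_axisPt_neg_6]; norm_num

/-- A priori bound: on `{f ≤ 10000}` one has `‖p‖² ≤ 1400000`. [folklore] -/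
theorem norm_sq_le_of_fn_le {p : 𝔼 3} (h : fn p ≤ 10000) :
    p 0 ^ 2 + p 1 ^ 2 + p 2 ^ 2 ≤ 1400000 := by
  simp only [fn] at h
  set s := p 0 ^ 2 + p 1 ^ 2 with hs
  have hs0 : 0 ≤ s := by positivity
  have h1 : 3840 * p 0 ≤ 1920 * (s + 1) := by nlinarith [sq_nonneg (p 0 - 1), sq_nonneg (p 1)]
  have h2 : s ^ 2 - 2312 * s + p 2 ^ 2 ≤ 11920 := by nlinarith [h, h1]
  have h3 : p 2 ^ 2 ≤ 1348256 := by nlinarith [h2, sq_nonneg (s - 1156)]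
  have h4 : s ≤ 2318 := by
    by_contra h4
    push Not at h4
    nlinarith [h2, sq_nonneg (p 2)]
  linarith

/-- **`{f ≤ 10000}` is compact** (closed and bounded in `ℝ³`). [folklore] -/
theorem isCompact_preimage_fn : IsCompact (fn ⁻¹' Iic (10000 : ℝ)) := by
  refine Metric.isCompact_of_isClosed_isBounded (isClosed_Iic.preimage contDiff_fn.continuous) ?_
  rw [isBounded_iff_forall_norm_le]
  refine ⟨1200, fun p hp => ?_⟩
  have h := norm_sq_le_of_fn_le (p := p) hp
  have hn : ‖p‖ ^ 2 = p 0 ^ 2 + p 1 ^ 2 + p 2 ^ 2 := by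
    rw [EuclideanSpace.norm_sq_eq, Fin.sum_univ_three]
    simp [Real.norm_eq_abs, sq_abs]
  nlinarith [norm_nonneg p]

end SolidTorusModel

/-! ### Connectedness of compact sublevel sets (non-compact ambient manifold) -/

section Connected

variable {k : ℕ} {M : Type u} [TopologicalSpace M] [ChartedSpace (𝔼 (k + 1)) M] {f : M → ℝ} {a : ℝ}

/-- **A compact sublevel set `{f ≤ a}` of a `C²` function with at most one critical point of
index `0` on a manifold without boundary is connected** (if nonempty): the variant of
`Literature.Topology.FourManifolds.isConnected_preimage_Iic` (`RegularLevelSplitting.lean`) for a possibly non-compact ambient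
manifold, same proof (Reeb's argument, Milnor, *Morse theory* (1963), proof of Thm. 4.1: two
closed pieces would carry two local minima, i.e. two critical points of index `0`).
[cite: Milnor1963, §3 and proof of Thm. 4.1] -/
theorem isConnected_preimage_Iic_of_isCompact (hf : ContMDiff (𝓡 (k + 1)) 𝓘(ℝ, ℝ) 2 f)
    (hK : IsCompact (f ⁻¹' Iic a)) (h0 : (criticalSetOfIndex (𝓡 (k + 1)) f 0).Subsingleton)
    (hne : (f ⁻¹' Iic a).Nonempty) : IsConnected (f ⁻¹' Iic a) := by
  refine ⟨hne, ?_⟩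
  rw [isPreconnected_iff_subset_of_disjoint_closed]
  intro u v hu hv huv hdisj
  by_contra hcon
  rw [not_or] at hcon
  obtain ⟨hSu, hSv⟩ := hcon
  obtain ⟨xv, hxvS, hxvu⟩ := not_subset.1 hSu
  obtain ⟨xu, hxuS, hxuv⟩ := not_subset.1 hSv
  have hxv : xv ∈ v := (huv hxvS).resolve_left hxvu
  have hxu : xu ∈ u := (huv hxuS).resolve_right hxuv
  have key : ∀ (u v : Set M), IsClosed u → IsClosed v → f ⁻¹' Iic a ⊆ u ∪ v →
      f ⁻¹' Iic a ∩ (u ∩ v) = ∅ → (f ⁻¹' Iic a ∩ u).Nonempty →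
      ∃ m ∈ f ⁻¹' Iic a ∩ u, m ∈ criticalSetOfIndex (𝓡 (k + 1)) f 0 := by
    intro u v hu hv huv hdisj hne
    obtain ⟨m, hm, hmin⟩ := (hK.inter_right hu).exists_isMinOn hne hf.continuous.continuousOn
    have hloc : IsLocalMin f m := isLocalMin_of_isMinOn_piece hv huv hdisj hm hmin
    exact ⟨m, hm, IsLocalMin.isMCriticalPt hloc, IsLocalMin.morseIndex_eq_zero (hf m) hloc⟩
  obtain ⟨m, hm, hmc⟩ := key u v hu hv huv hdisj ⟨xu, hxuS, hxu⟩
  obtain ⟨m', hm', hm'c⟩ := key v u hv hu (by rwa [union_comm]) (by rwa [inter_comm v u])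
    ⟨xv, hxvS, hxv⟩
  have hmm' : m = m' := h0 hmc hm'c
  have : m ∈ f ⁻¹' Iic a ∩ (u ∩ v) := ⟨hm.1, hm.2, hmm' ▸ hm'.2⟩
  rw [hdisj] at this
  exact this

/-- `Mᵃ` is compact when the sublevel set `{f ≤ a}` is. [folklore] -/
theorem RegularSublevel.compactSpace_of_isCompact (h : IsRegularLevel (𝓡 (k + 1)) f a)
    (hK : IsCompact (f ⁻¹' Iic a)) : CompactSpace (RegularSublevel h) :=
  isCompact_iff_compactSpace.1 hK

/-- `Mᵃ` is connected when `{f ≤ a}` is compact and nonempty and `f` (`C²`) has at most one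
critical point of index `0`. [cite: Milnor1963, §3 and proof of Thm. 4.1] -/
theorem RegularSublevel.connectedSpace_of_isCompact (h : IsRegularLevel (𝓡 (k + 1)) f a)
    (hK : IsCompact (f ⁻¹' Iic a)) (h0 : (criticalSetOfIndex (𝓡 (k + 1)) f 0).Subsingleton)
    (hne : ∃ x, f x ≤ a) : ConnectedSpace (RegularSublevel h) :=
  isConnected_iff_connectedSpace.1
    (isConnected_preimage_Iic_of_isCompact (h.contMDiff.of_le (by norm_cast)) hK h0 hne)

end Connected

namespace SolidTorusModel

/-- **The solid torus** `V₁ = {f ≤ 10000} ⊂ ℝ³`, a regular sublevel set of the Morse function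
`f` (`Literature.Topology.FourManifolds.RegularSublevel`: a smooth compact `3`-manifold with boundary the torus
`{f = 10000}`). [folklore] -/
abbrev SolidTorus : Type := RegularSublevel isRegularLevel_fn

/-- `V₁` is compact. [folklore] -/
instance : CompactSpace SolidTorus :=
  RegularSublevel.compactSpace_of_isCompact _ isCompact_preimage_fn

/-- `V₁` is connected (one critical point of index `0`). [folklore] -/
instance : ConnectedSpace SolidTorus :=
  RegularSublevel.connectedSpace_of_isCompact _ isCompact_preimage_fn
    (by rw [criticalSetOfIndex_fn]; exact subsingleton_singleton)
    ⟨axisPt 16, by rw [fn_axisPt_16]; norm_num⟩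

/-- `V₁` is orientable (a codimension-`0` submanifold of `ℝ³`). [folklore] -/
theorem isOrientable_solidTorus : IsOrientable (𝓡∂ 3) SolidTorus :=
  RegularSublevel.isOrientable _ (isOrientable_euclideanSpace 3)

/-- The handle count of `V₁`: one `0`-handle, one `1`-handle, nothing else. [folklore] -/
theorem ncard_criticalSetOfIndex_inter (i : ℕ) :
    (criticalSetOfIndex (𝓡 3) fn i ∩ fn ⁻¹' Iic (10000 : ℝ)).ncard = handleCount 1 1 i := by
  rw [criticalSetOfIndex_fn]
  rcases Nat.lt_or_ge i 3 with hi | hi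
  · interval_cases i
    · have : ({axisPt 16} : Set (𝔼 3)) ∩ fn ⁻¹' Iic (10000 : ℝ) = {axisPt 16} := by
        refine inter_eq_left.2 (singleton_subset_iff.2 ?_)
        show fn (axisPt 16) ≤ 10000
        rw [fn_axisPt_16]; norm_num
      simp [this]
    · have : ({axisPt (-10)} : Set (𝔼 3)) ∩ fn ⁻¹' Iic (10000 : ℝ) = {axisPt (-10)} := by
        refine inter_eq_left.2 (singleton_subset_iff.2 ?_)
        show fn (axisPt (-10)) ≤ 10000
        rw [fn_axisPt_neg_10]; norm_num
      simp [this]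
    · have : ({axisPt (-6)} : Set (𝔼 3)) ∩ fn ⁻¹' Iic (10000 : ℝ) = ∅ := by
        refine eq_empty_of_forall_notMem fun p hp => ?_
        have h1 : p = axisPt (-6) := hp.1
        have h2 : fn p ≤ 10000 := hp.2
        rw [h1, fn_axisPt_neg_6] at h2
        norm_num at h2
      simp [this, handleCount]
  · have h0 : i ≠ 0 := by omega
    have h1 : i ≠ 1 := by omega
    have h2 : i ≠ 2 := by omega
    simp [h0, h1, h2, handleCount]

/-- **`V₁` has a handle decomposition with one `0`-handle and one `1`-handle** (the Morse
function `f|V₁ - 9999`). [folklore] -/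
theorem hasHandleDecomposition_solidTorus :
    HasHandleDecomposition 2 SolidTorus (handleCount 1 1) := by
  have hd := RegularSublevel.hasHandleDecomposition isMorse_fn isRegularLevel_fn
  have hfun : (fun i => (criticalSetOfIndex (𝓡 3) fn i ∩ fn ⁻¹' Iic (10000 : ℝ)).ncard) =
      handleCount 1 1 := funext ncard_criticalSetOfIndex_inter
  rw [hfun] at hd
  exact hd

/-- **The solid torus `V₁ = {f ≤ 10000} ⊂ ℝ³` is a genus-`1` handlebody** (`Literature.Topology.FourManifolds.IsHandlebody`:
compact, connected, orientable, with a handle decomposition into one `0`-handle and one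
`1`-handle) — so genus-`1` handlebodies exist and `Literature.IsHandlebody 1` is inhabited (Schultens,
*Introduction to 3-Manifolds* (2014), Def. 6.1.5 and Example 6.1.9: the solid torus is the
handlebody of genus one). [cite: Schultens2014, Def. 6.1.5] -/
theorem isHandlebody_one_solidTorus : IsHandlebody 1 SolidTorus :=
  ⟨inferInstance, inferInstance, isOrientable_solidTorus, hasHandleDecomposition_solidTorus⟩

end SolidTorusModel

end Literature.Topology.FourManifolds
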